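import Summits.Ventures.DiscreteObjects.Hadamard.OrbitSums
import Summits.Ventures.DiscreteObjects.Hadamard.ResignOddOrder
import Summits.Ventures.DiscreteObjects.Hadamard.AutomorphismFixedRows668

/-!
# The Hadamard form of the orbit matrix for a SIGNED automorphism of odd prime order (kernel): re-sign, then the orbit-sum identity

Framing: lottery ticket; floor = certified bounds/negative ranges.

Cell pub-namedobj (venture DiscreteObjects), target (H), hadamard gen 7 (FAMILY-F12-G7 §2).  Composition of `exists_resign_of_odd`
(ResignOddOrder) and `orbitSum_identity` (OrbitSums): for a Hadamard matrix `H` of order `n` with a signed-permutation automorphism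
`(π, κ, d, e)`, `π ^ p = κ ^ p = 1`, `p` an odd prime, there is an equivalent Hadamard matrix `H' i j = s i * t j * H i j` (signs
`s, t = ±1`) on which `(π, κ)` acts as a permutation automorphism pair, and its orbit block sums satisfy the weighted identity
`∑_j w j · bsum i j · bsum i' j = p² · n · |orbit(i) ∩ orbit(i')|` — i.e. the orbit-sum matrix `Θ = [[A, √p B],[√p C, F]]` of `H'`
has `Θ Θᵀ = n·I`.  For H(668) and `p = 41` this is the starting identity of the orbit-matrix analysis whose solutions are exhibited in
`Z41OrbitMatrixCertificate` (orbit matrices exist) and whose (R3) part is `FixedSubmatrix41`.  Ours, not literature; no `sorry`.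
-/

open Finset BigOperators Matrix

namespace Summit.Ventures.DiscreteObjects.Hadamard

open Literature.Combinatorics.Designs.GoethalsSeidel (IsHadamardMatrix)

variable {ι : Type*} [Fintype ι] [DecidableEq ι]

/-- **Orbit-sum identity for a signed automorphism of odd prime order** (after re-signing). -/
theorem orbitSum_identity_signed {H : Matrix ι ι ℤ} (hH : IsHadamardMatrix H) {π κ : Equiv.Perm ι} {d e : ι → ℤ}
    (haut : IsSignedAut H π κ d e) {p : ℕ} (hp : p.Prime) (hodd : Odd p) (hπ : π ^ p = 1) (hκ : κ ^ p = 1) :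
    ∃ s t : ι → ℤ, (∀ i, s i = 1 ∨ s i = -1) ∧ (∀ j, t j = 1 ∨ t j = -1) ∧
      IsHadamardMatrix (Matrix.of fun i j => s i * t j * H i j) ∧
      (∀ i j, (Matrix.of fun i j => s i * t j * H i j) (π i) (κ j) = (Matrix.of fun i j => s i * t j * H i j) i j) ∧
      ∀ i i' : ι,
        ∑ j, (if κ j = j then ((p : ℤ) ^ 2) else 1) *
            bsum (Matrix.of fun i j => s i * t j * H i j) π κ p i j *
            bsum (Matrix.of fun i j => s i * t j * H i j) π κ p i' j =
          (p : ℤ) ^ 2 * (Fintype.card ι : ℤ) * ((orbFin π p i ∩ orbFin π p i').card : ℤ) := by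
  obtain ⟨s, t, hs, ht, hH', hinv⟩ := exists_resign_of_odd hH haut hodd hπ hκ
  have hinv' : ∀ i j, (Matrix.of fun i j => s i * t j * H i j) (π i) (κ j) =
      (Matrix.of fun i j => s i * t j * H i j) i j := by
    intro i j; simp only [Matrix.of_apply]; exact hinv i j
  exact ⟨s, t, hs, ht, hH', hinv', fun i i' => orbitSum_identity _ π κ p hH' hinv' hp hπ hκ i i'⟩

/-- **H(668), order 41**: the re-signed matrix has `(π, κ)` as a permutation automorphism pair with exactly `12` fixed rows and `12`
fixed columns, and the orbit-sum identity holds with `p = 41`, `n = 668` — the Hadamard form `Θ Θᵀ = 668·I` of the Z₄₁ orbit matrix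
(16 + 12 rows/columns), whose solvability is certified in `Z41OrbitMatrixCertificate`. -/
theorem hadamard668_orbitSum_identity_41 {H : Matrix ι ι ℤ} (hH : IsHadamardMatrix H) (hι : Fintype.card ι = 668)
    (π κ : Equiv.Perm ι) (d e : ι → ℤ) (haut : IsSignedAut H π κ d e)
    (hπ : π ^ 41 = 1) (hκ : κ ^ 41 = 1) (hne : π ≠ 1 ∨ κ ≠ 1) :
    (univ.filter fun i => π i = i).card = 12 ∧ (univ.filter fun j => κ j = j).card = 12 ∧
    ∃ s t : ι → ℤ, (∀ i, s i = 1 ∨ s i = -1) ∧ (∀ j, t j = 1 ∨ t j = -1) ∧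
      IsHadamardMatrix (Matrix.of fun i j => s i * t j * H i j) ∧
      (∀ i j, (Matrix.of fun i j => s i * t j * H i j) (π i) (κ j) = (Matrix.of fun i j => s i * t j * H i j) i j) ∧
      ∀ i i' : ι,
        ∑ j, (if κ j = j then ((41 : ℤ) ^ 2) else 1) *
            bsum (Matrix.of fun i j => s i * t j * H i j) π κ 41 i j *
            bsum (Matrix.of fun i j => s i * t j * H i j) π κ 41 i' j =
          (41 : ℤ) ^ 2 * 668 * ((orbFin π 41 i ∩ orbFin π 41 i').card : ℤ) := by
  have hcount := hadamard668_fixedRows_41 hH hι π κ d e haut hπ hκ hne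
  refine ⟨hcount.1, hcount.2, ?_⟩
  obtain ⟨s, t, hs, ht, hH', hinv', hid⟩ :=
    orbitSum_identity_signed hH haut (by norm_num : (41 : ℕ).Prime) (by decide : Odd 41) hπ hκ
  refine ⟨s, t, hs, ht, hH', hinv', fun i i' => ?_⟩
  have h := hid i i'
  rw [hι] at h
  exact_mod_cast h

end Summit.Ventures.DiscreteObjects.Hadamard
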